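import Literature.Geometry.Riemannian.BakryEmeryHeatFlow
import HarnessLib

/-!
# The entropy–energy inequality along the heat flow from the dimensional Fisher dissipation
(stub `stub_entropyEnergy_alongFlow` = B2 of line `curvature-dimension-entropy-floor`, crux
`EntropyRung.SubcylindricalExistence`, item stmt-SmoothPoincare4-10871)

On a closed Riemannian 4-manifold `(M, g)` (Levi-Civita connection) with `Ric ≥ K g`, `K > 0`, let
`f` be smooth on `M × [0, ∞)` with `∂ₜf = Δf − |∇f|²` (so `u = e^{-f}` solves the heat equation),
of unit mass `∫ e^{-f(t,·)} e^{-c} dV = 1` for a constant weight `e^{-c}`, and with entropy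
`H(t) = ∫ (−f) e^{-f} e^{-c} dV → 0`. Put `I(t) = ∫ |∇f|² e^{-f} e^{-c} dV` (Fisher information) and
`D(t) = ∫ (Δf)² e^{-f} e^{-c} dV`.

* `entropyEnergy_of_dissipation` — the ODE core: if `H, I` are continuous on `[0, ∞)`,
  `H' = −I`, `I' ≤ −2K I − ½ I²`, `I ≥ 0` and `H(T) → 0`, then `H(0) ≤ 2 log(1 + I(0)/(4K))`
  (the quantity `Ψ = H − 2 log(1 + I/(4K))` is nondecreasing and `Ψ ≤ H → 0`).
* `sq_integral_le_integral_sq_of_mass_one` — Cauchy–Schwarz/Jensen for a unit-mass weight: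
  `(∫ a w)² ≤ ∫ a² w`.
* `hessian_const_eq_zero`, `innerDual_mvfderiv_const_left` — a constant weight has no Hessian and
  no drift (`Hess c = 0`, `g⁻¹(dc, ·) = 0`).
* `integral_dalembertian_mul_exp_neg` — Green: `∫ (Δf) e^{-f} e^{-c} dV = ∫ |∇f|² e^{-f} e^{-c} dV`.
* `stub_entropyEnergy_alongFlow` (the registered stub): the DIMENSIONAL Fisher dissipation
  `∫ ∂ₜ(|∇f|² e^{-f} e^{-V}) ≤ −2K I − ½ D` (statement B1 of the line, taken as hypothesis, at the
  constant weight `V ≡ c`) implies `H(0) ≤ 2 log(1 + I(0)/(4K))`: `D ≥ I²` by Cauchy–Schwarz and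
  `∫ Δf e^{-f} e^{-c} = I`, `H' = −I` (`hasDerivAt_entropy`), Leibniz rule for `I`
  (`hasDerivAt_integral_of_continuousOn_prod`), and the ODE core.

Everything is proved; no definition, no named fact.

References: D. Bakry, I. Gentil, M. Ledoux, *Analysis and Geometry of Markov Diffusion Operators*
(2014), §6 (Sobolev inequalities under `CD(ρ, n)`) [BakryGentilLedoux2014]; J. A. Carrillo, L. Ni,
Comm. Anal. Geom. 17 (2009), §3 [CarrilloNi2009]; B. O'Neill, *Semi-Riemannian geometry* (1983),
Ch. 3, Def. 3.48 [ONeill1983].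
-/

noncomputable section

-- the registered namespace `Summit.SmoothPoincare4.SmoothPoincare4.Theorems` repeats a component
set_option linter.dupNamespace false

open Bundle Set Function Filter Module MeasureTheory
open scoped Manifold ContDiff Topology ENNReal

namespace Summit.SmoothPoincare4.SmoothPoincare4.Theorems

open Literature.Geometry Literature.Geometry.Lorentzian Literature.Geometry.Riemannian
  Literature.Geometry.Lorentzian.PseudoRiemannianMetric

/-! ## The real-variable cores -/

/-- **Algebra of the monotone quantity**: for `K > 0`, `a ≥ 0` and `b ≤ −2K a − ½ a²`,
`0 ≤ −a − 2 · ((1/(4K)) b)/(1 + (1/(4K)) a)` (indeed `−2b/(4K + a) ≥ a`). [folklore] -/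
theorem entropyEnergy_deriv_nonneg {K a b : ℝ} (hK : 0 < K) (ha : 0 ≤ a)
    (hb : b ≤ -2 * K * a - (1 / 2 : ℝ) * a ^ 2) :
    0 ≤ -a - 2 * ((1 / (4 * K)) * b / (1 + (1 / (4 * K)) * a)) := by
  have h4K : (0 : ℝ) < 4 * K := by positivity
  have hden : 0 < 4 * K + a := by linarith
  have hkey : (1 / (4 * K)) * b / (1 + (1 / (4 * K)) * a) = b / (4 * K + a) := by
    field_simp
  rw [hkey]
  have hkey2 : -a - 2 * (b / (4 * K + a)) = (-a * (4 * K + a) - 2 * b) / (4 * K + a) := by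
    field_simp
  rw [hkey2]
  exact div_nonneg (by nlinarith) hden.le

/-- **The ODE core of the dimensional Bakry–Émery argument.** If `H, I` are continuous on
`[0, ∞)`, `H' = −I` and `I' ≤ −2K I − ½ I²` on `(0, ∞)`, `I ≥ 0`, `K > 0` and `H(T) → 0` as
`T → ∞`, then `H(0) ≤ 2 log(1 + I(0)/(4K))`: the quantity `Ψ = H − 2 log(1 + I/(4K))` is
continuous on `[0, ∞)` with `Ψ' = −I − 2I'/(4K + I) ≥ 0` on `(0, ∞)`, hence nondecreasing
(`monotoneOn_of_deriv_nonneg`), and `Ψ(0) ≤ Ψ(T) ≤ H(T) → 0`. This is the integration of the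
differential inequality behind the entropy–energy inequality `Ent ≤ (n/2) log(1 + 2I/(nρ))` of
curvature–dimension `CD(ρ, n)` (here `n = 4`, `ρ = K`). [cite: BakryGentilLedoux2014, §6] -/
theorem entropyEnergy_of_dissipation {H I I' : ℝ → ℝ} {K : ℝ} (hK : 0 < K)
    (hHc : ContinuousOn H (Ici 0)) (hIc : ContinuousOn I (Ici 0))
    (hHd : ∀ t, 0 < t → HasDerivAt H (-I t) t)
    (hId : ∀ t, 0 < t → HasDerivAt I (I' t) t)
    (hI' : ∀ t, 0 < t → I' t ≤ -2 * K * I t - (1 / 2 : ℝ) * (I t) ^ 2)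
    (hInn : ∀ t, 0 ≤ t → 0 ≤ I t)
    (hlim : Tendsto H atTop (𝓝 0)) :
    H 0 ≤ 2 * Real.log (1 + (1 / (4 * K)) * I 0) := by
  set Ψ : ℝ → ℝ := fun s ↦ H s - 2 * Real.log (1 + (1 / (4 * K)) * I s) with hΨ
  have hq : (0 : ℝ) ≤ 1 / (4 * K) := by positivity
  have hpos : ∀ t, 0 ≤ t → 0 < 1 + (1 / (4 * K)) * I t := fun t ht ↦ by
    have := mul_nonneg hq (hInn t ht)
    linarith
  have hΨc : ContinuousOn Ψ (Ici 0) := by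
    refine hHc.sub (continuousOn_const.mul ?_)
    refine ContinuousOn.log (continuousOn_const.add (continuousOn_const.mul hIc)) ?_
    intro t ht
    exact (hpos t ht).ne'
  have hΨd : ∀ t, 0 < t → HasDerivAt Ψ
      (-I t - 2 * ((1 / (4 * K)) * I' t / (1 + (1 / (4 * K)) * I t))) t := by
    intro t ht
    have h1 : HasDerivAt (fun s ↦ 1 + (1 / (4 * K)) * I s) ((1 / (4 * K)) * I' t) t := by
      simpa using ((hId t ht).const_mul (1 / (4 * K))).const_add 1
    have h2 := h1.log (hpos t ht.le).ne'
    exact (hHd t ht).sub (h2.const_mul 2)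
  have hmono : MonotoneOn Ψ (Ici 0) := by
    refine monotoneOn_of_deriv_nonneg (convex_Ici 0) hΨc ?_ ?_
    · rw [interior_Ici]
      exact fun t ht ↦ (hΨd t ht).differentiableAt.differentiableWithinAt
    · rw [interior_Ici]
      intro t ht
      rw [(hΨd t ht).deriv]
      exact entropyEnergy_deriv_nonneg hK (hInn t (le_of_lt ht)) (hI' t ht)
  -- `Ψ(0) ≤ Ψ(T) ≤ H(T)` for `T ≥ 0`, and `H(T) → 0`
  have hle : ∀ T, 0 ≤ T → Ψ 0 ≤ H T := by
    intro T hT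
    have h := hmono (self_mem_Ici (a := (0 : ℝ))) (show T ∈ Ici (0 : ℝ) from hT) hT
    have hlog : 0 ≤ Real.log (1 + (1 / (4 * K)) * I T) :=
      Real.log_nonneg (by linarith [mul_nonneg hq (hInn T hT)])
    have hT' : Ψ T ≤ H T := by
      simp only [hΨ]
      linarith
    exact h.trans hT'
  have hev : ∀ᶠ T in atTop, Ψ 0 ≤ H T := eventually_atTop.2 ⟨0, hle⟩
  have hfin := ge_of_tendsto hlim hev
  have h0 : Ψ 0 = H 0 - 2 * Real.log (1 + (1 / (4 * K)) * I 0) := rfl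
  linarith

/-- **Cauchy–Schwarz for a unit-mass weight**: for `w ≥ 0` with `∫ w dμ = 1`,
`(∫ a w dμ)² ≤ ∫ a² w dμ` (expand `0 ≤ ∫ (a − A)² w dμ`, `A = ∫ a w dμ`). [folklore] -/
theorem sq_integral_le_integral_sq_of_mass_one {α : Type*} [MeasurableSpace α] {μ : Measure α}
    {a w : α → ℝ} (hw : ∀ x, 0 ≤ w x) (h0 : Integrable w μ)
    (h1 : Integrable (fun x ↦ a x * w x) μ) (h2 : Integrable (fun x ↦ a x ^ 2 * w x) μ)
    (hmass : ∫ x, w x ∂μ = 1) :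
    (∫ x, a x * w x ∂μ) ^ 2 ≤ ∫ x, a x ^ 2 * w x ∂μ := by
  set A : ℝ := ∫ x, a x * w x ∂μ with hA
  have hnn : 0 ≤ ∫ x, (a x - A) ^ 2 * w x ∂μ :=
    integral_nonneg fun x ↦ mul_nonneg (sq_nonneg _) (hw x)
  have i3 : Integrable (fun x ↦ a x ^ 2 * w x - 2 * A * (a x * w x)) μ :=
    h2.sub (h1.const_mul _)
  have s1 : ∫ x, (a x - A) ^ 2 * w x ∂μ =
      ∫ x, (a x ^ 2 * w x - 2 * A * (a x * w x)) + A ^ 2 * w x ∂μ :=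
    integral_congr_ae (Eventually.of_forall fun x ↦ by ring)
  have s2 : ∫ x, (a x ^ 2 * w x - 2 * A * (a x * w x)) + A ^ 2 * w x ∂μ =
      ∫ x, (a x ^ 2 * w x - 2 * A * (a x * w x)) ∂μ + ∫ x, A ^ 2 * w x ∂μ :=
    integral_add i3 (h0.const_mul _)
  have s3 : ∫ x, (a x ^ 2 * w x - 2 * A * (a x * w x)) ∂μ =
      ∫ x, a x ^ 2 * w x ∂μ - ∫ x, 2 * A * (a x * w x) ∂μ :=
    integral_sub h2 (h1.const_mul _)
  have s4 : ∫ x, 2 * A * (a x * w x) ∂μ = 2 * A * A := by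
    rw [integral_const_mul]
  have s5 : ∫ x, A ^ 2 * w x ∂μ = A ^ 2 := by
    rw [integral_const_mul, hmass, mul_one]
  nlinarith [hnn, s1, s2, s3, s4, s5]

/-! ## A constant weight has neither Hessian nor drift -/

section Const

variable {E : Type*} [NormedAddCommGroup E] [NormedSpace ℝ E] [FiniteDimensional ℝ E]
  {H : Type*} [TopologicalSpace H]
  {I : ModelWithCorners ℝ E H} {M : Type*} [TopologicalSpace M] [ChartedSpace H M]
  [IsManifold I ∞ M]
  (g : PseudoRiemannianMetric I ∞ E (TangentSpace I : M → Type _))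

omit [FiniteDimensional ℝ E] in
/-- **The Hessian of a constant vanishes** (`Hess c = ∇(dc) = 0`; O'Neill 1983, Ch. 3, Def. 3.48)
— a local copy of `PseudoRiemannianMetric.hessian_const` of `Lorentzian/BlackHoles.lean` (not
imported here). [cite: ONeill1983, Ch. 3, Def. 3.48] -/
theorem hessian_const_eq_zero [g.HasLeviCivita] (c : ℝ) (x : M) :
    g.hessian (fun _ : M ↦ c) x = 0 := by
  have haux : ∀ X Y : Π x : M, TangentSpace I x, g.hessianAux (fun _ : M ↦ c) X Y x = 0 := by
    intro X Y
    simp [PseudoRiemannianMetric.hessianAux, mvfderiv_const]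
  unfold PseudoRiemannianMetric.hessian
  have hex : ∃ B : LinearMap.BilinForm ℝ (TangentSpace I x), ∀ X₀ Y₀ : TangentSpace I x,
      B X₀ Y₀ =
        g.hessianAux (fun _ : M ↦ c) (FiberBundle.extend E X₀) (FiberBundle.extend E Y₀) x :=
    ⟨0, fun _ _ ↦ by simp [haux]⟩
  rw [dif_pos hex]
  ext X₀ Y₀
  simpa [haux] using hex.choose_spec X₀ Y₀

/-- **A constant weight has no drift**: `g⁻¹(dc, β) = 0` since `dc = 0`. [folklore] -/
theorem innerDual_mvfderiv_const_left (c : ℝ) (x : M) (β : Module.Dual ℝ (TangentSpace I x)) :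
    g.innerDual x (mvfderiv I (fun _ : M ↦ c) x : TangentSpace I x →ₗ[ℝ] ℝ) β = 0 := by
  have h0 : (mvfderiv I (fun _ : M ↦ c) x : TangentSpace I x →ₗ[ℝ] ℝ) = 0 := by
    rw [mvfderiv_const]
    rfl
  rw [h0]
  simp [PseudoRiemannianMetric.innerDual]

end Const

/-! ## Green: `∫ (Δf) e^{-f} e^{-c} dV = ∫ |∇f|² e^{-f} e^{-c} dV` -/

section Green

variable {E : Type*} [NormedAddCommGroup E] [NormedSpace ℝ E] [FiniteDimensional ℝ E]
  {H : Type*} [TopologicalSpace H] {I : ModelWithCorners ℝ E H} [I.Boundaryless]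
  {M : Type*} [TopologicalSpace M] [ChartedSpace H M] [IsManifold I ∞ M]
  [CompactSpace M] [T3Space M] [MeasurableSpace M] [BorelSpace M]
  (g : PseudoRiemannianMetric I ∞ E (TangentSpace I : M → Type _)) [g.HasLeviCivita]

/-- **`∫ (Δ_g F) e^{-F} e^{-c} dV_g = ∫ |∇F|² e^{-F} e^{-c} dV_g`** on a closed Riemannian manifold
(any model), `F` smooth: Green's first identity `∫ e^{-F} ΔF = −∫ g⁻¹(d e^{-F}, dF)`
(`integral_mul_dalembertian_riemVolume`) with `d(e^{-F}) = −e^{-F} dF`. This is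
`∫ Δu dV = 0` for `u = e^{-F}`, `Δ(e^{-F}) = e^{-F}(|∇F|² − ΔF)` (Carrillo–Ni 2009, §3).
[cite: CarrilloNi2009, §3 (3.1)–(3.2)] -/
theorem integral_dalembertian_mul_exp_neg (hg : g.IsRiemannian) {F : M → ℝ}
    (hF : ContMDiff I 𝓘(ℝ, ℝ) ∞ F) (c : ℝ) :
    ∫ x, g.dalembertian F x * Real.exp (-F x) * Real.exp (-c) ∂g.riemVolume =
      ∫ x, g.gradSq F x * Real.exp (-F x) * Real.exp (-c) ∂g.riemVolume := by
  have hF1 : ContMDiff I 𝓘(ℝ, ℝ) 1 F := hF.of_le (by norm_num)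
  have hF2 : ContMDiff I 𝓘(ℝ, ℝ) 2 F := hF.of_le (WithTop.coe_le_coe.mpr le_top)
  have hU1 : ContMDiff I 𝓘(ℝ, ℝ) 1 (fun y ↦ Real.exp (-F y)) :=
    ((Real.contDiff_exp.comp contDiff_neg).comp_contMDiff hF).of_le (by norm_num)
  have hG := integral_mul_dalembertian_riemVolume g hg hU1 hF2
  have hpt : ∀ x, g.innerDual x
      (mvfderiv I (fun y ↦ Real.exp (-F y)) x : TangentSpace I x →ₗ[ℝ] ℝ)
      (mvfderiv I F x : TangentSpace I x →ₗ[ℝ] ℝ) = -Real.exp (-F x) * g.gradSq F x := by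
    intro x
    rw [mvfderiv_exp_neg_toLinearMap (hF1.mdifferentiableAt one_ne_zero), g.innerDual_smul_left]
    rfl
  have e3 : ∫ x, Real.exp (-F x) * g.dalembertian F x ∂g.riemVolume =
      ∫ x, Real.exp (-F x) * g.gradSq F x ∂g.riemVolume := by
    rw [hG, ← integral_neg]
    refine integral_congr_ae (Eventually.of_forall fun x ↦ ?_)
    dsimp only
    rw [hpt x]
    ring
  have e1 : ∫ x, g.dalembertian F x * Real.exp (-F x) * Real.exp (-c) ∂g.riemVolume =
      (∫ x, Real.exp (-F x) * g.dalembertian F x ∂g.riemVolume) * Real.exp (-c) := by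
    rw [← integral_mul_const]
    exact integral_congr_ae (Eventually.of_forall fun x ↦ by ring)
  have e2 : ∫ x, g.gradSq F x * Real.exp (-F x) * Real.exp (-c) ∂g.riemVolume =
      (∫ x, Real.exp (-F x) * g.gradSq F x ∂g.riemVolume) * Real.exp (-c) := by
    rw [← integral_mul_const]
    exact integral_congr_ae (Eventually.of_forall fun x ↦ by ring)
  rw [e1, e2, e3]

end Green

/-! ## The registered stub -/

/-- **STUB `stub_entropyEnergy_alongFlow` (B2) of line `curvature-dimension-entropy-floor` —
`DimensionalFisherDissipation → EntropyEnergyAlongFlow`.** HYPOTHESIS (B1): on every closed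
4-manifold of the summit binder, for `g` Riemannian with Levi-Civita connection, `V` smooth with
`K g ≤ Ric + Hess V` and `f` smooth on `M × [0, ∞)` solving `∂ₜf = Δf − g⁻¹(dV, df) − |∇f|²`,
`∫ ∂ₜ(|∇f|² e^{-f} e^{-V}) dV ≤ −2K ∫ |∇f|² e^{-f} e^{-V} dV − ½ ∫ (Δf)² e^{-f} e^{-V} dV`.
CONCLUSION (B2): for `Ric ≥ K g`, `K > 0`, a constant weight `e^{-c}` and `f` smooth on
`M × [0, ∞)` with `∂ₜf = Δf − |∇f|²`, unit mass `∫ e^{-f(t,·)} e^{-c} dV = 1` (`t ≥ 0`) and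
`H(t) = ∫ (−f) e^{-f} e^{-c} dV → 0`, one has `H(0) ≤ 2 log(1 + I(0)/(4K))`,
`I(t) = ∫ |∇f(t,·)|² e^{-f(t,·)} e^{-c} dV`. Proof: at `V ≡ c` the drift and the Hessian vanish
(`innerDual_mvfderiv_const_left`, `hessian_const_eq_zero`), so B1, the Leibniz rule
(`hasDerivAt_integral_of_continuousOn_prod`, `continuousOn_integral_of_continuousOn_prod`) and
`hasDerivAt_entropy` give `I` continuous on `[0, ∞)` with `I' ≤ −2K I − ½ D` and `H' = −I` on
`(0, ∞)`; Green (`integral_dalembertian_mul_exp_neg`) gives `∫ Δf e^{-f} e^{-c} = I`, whence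
`D ≥ I²` by Cauchy–Schwarz at unit mass (`sq_integral_le_integral_sq_of_mass_one`); conclude by
the ODE core `entropyEnergy_of_dissipation`. [cite: BakryGentilLedoux2014, §6]
[cite: CarrilloNi2009, §3] -/
theorem stub_entropyEnergy_alongFlow :
    (∀ (M : Type) [TopologicalSpace M] [T2Space M] [SecondCountableTopology M]
      [ChartedSpace (EuclideanSpace ℝ (Fin 4)) M] [IsManifold (𝓡 4) ∞ M] [CompactSpace M] [T3Space M]
      [MeasurableSpace M] [BorelSpace M]
      (g : PseudoRiemannianMetric (𝓡 4) ∞ (EuclideanSpace ℝ (Fin 4)) (TangentSpace (𝓡 4) : M → Type _))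
      [g.HasLeviCivita] (_hg : g.IsRiemannian) (V : M → ℝ) (K : ℝ), ContMDiff (𝓡 4) 𝓘(ℝ, ℝ) ∞ V →
      (∀ (y : M) (X : TangentSpace (𝓡 4) y), K * g.val y X X ≤ g.ricci y X X + g.hessian V y X X) →
      ∀ f : ℝ → M → ℝ,
        ContMDiffOn ((𝓡 4).prod 𝓘(ℝ, ℝ)) 𝓘(ℝ, ℝ) ∞ (fun p : M × ℝ ↦ f p.2 p.1) (univ ×ˢ Ici 0) →
        (∀ t ∈ Ici (0 : ℝ), ∀ y : M, derivWithin (fun s ↦ f s y) (Ici 0) t =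
          g.dalembertian (f t) y
            - g.innerDual y (mvfderiv (𝓡 4) V y : TangentSpace (𝓡 4) y →ₗ[ℝ] ℝ)
                (mvfderiv (𝓡 4) (f t) y : TangentSpace (𝓡 4) y →ₗ[ℝ] ℝ)
            - g.gradSq (f t) y) →
        ∀ t ∈ Ici (0 : ℝ),
          ∫ y, derivWithin (fun s ↦ g.gradSq (f s) y * Real.exp (-f s y) * Real.exp (-V y)) (Ici 0) t
              ∂g.riemVolume ≤
            -2 * K * ∫ y, g.gradSq (f t) y * Real.exp (-f t y) * Real.exp (-V y) ∂g.riemVolume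
              - (1 / 2 : ℝ) * ∫ y, (g.dalembertian (f t) y) ^ 2 * Real.exp (-f t y) * Real.exp (-V y)
                  ∂g.riemVolume) →
    ∀ (M : Type) [TopologicalSpace M] [T2Space M] [SecondCountableTopology M]
      [ChartedSpace (EuclideanSpace ℝ (Fin 4)) M] [IsManifold (𝓡 4) ∞ M] [CompactSpace M] [T3Space M]
      [MeasurableSpace M] [BorelSpace M]
      (g : PseudoRiemannianMetric (𝓡 4) ∞ (EuclideanSpace ℝ (Fin 4)) (TangentSpace (𝓡 4) : M → Type _))
      [g.HasLeviCivita] (_hg : g.IsRiemannian) (c K : ℝ), 0 < K →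
      (∀ (y : M) (X : TangentSpace (𝓡 4) y), K * g.val y X X ≤ g.ricci y X X) →
      ∀ f : ℝ → M → ℝ,
        ContMDiffOn ((𝓡 4).prod 𝓘(ℝ, ℝ)) 𝓘(ℝ, ℝ) ∞ (fun p : M × ℝ ↦ f p.2 p.1) (univ ×ˢ Ici 0) →
        (∀ t ∈ Ici (0 : ℝ), ∀ y : M, derivWithin (fun s ↦ f s y) (Ici 0) t =
          g.dalembertian (f t) y - g.gradSq (f t) y) →
        (∀ t ∈ Ici (0 : ℝ), ∫ y, Real.exp (-f t y) * Real.exp (-c) ∂g.riemVolume = 1) →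
        Filter.Tendsto (fun s ↦ ∫ y, (-f s y) * Real.exp (-f s y) * Real.exp (-c) ∂g.riemVolume)
          Filter.atTop (𝓝 0) →
        ∫ y, (-f 0 y) * Real.exp (-f 0 y) * Real.exp (-c) ∂g.riemVolume ≤
          2 * Real.log (1 + (1 / (4 * K)) *
            ∫ y, g.gradSq (f 0) y * Real.exp (-f 0 y) * Real.exp (-c) ∂g.riemVolume) := by
  intro hB1 M _ _ _ _ _ _ _ _ _ g _ hg c K hK hRic f hf heq hmass hlim
  haveI : IsFiniteMeasure g.riemVolume := ⟨g.riemVolume_univ_lt_top⟩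
  have hS : UniqueDiffOn ℝ (Ici (0 : ℝ)) := uniqueDiffOn_Ici 0
  -- the constant weight `V ≡ c`: no Hessian, no drift
  have hV : ContMDiff (𝓡 4) 𝓘(ℝ, ℝ) ∞ (fun _ : M ↦ c) := contMDiff_const
  have hRic' : ∀ (y : M) (X : TangentSpace (𝓡 4) y),
      K * g.val y X X ≤ g.ricci y X X + g.hessian (fun _ : M ↦ c) y X X := by
    intro y X
    rw [hessian_const_eq_zero g c y, LinearMap.zero_apply, LinearMap.zero_apply, add_zero]
    exact hRic y X
  have heq' : ∀ t ∈ Ici (0 : ℝ), ∀ y : M, derivWithin (fun s ↦ f s y) (Ici 0) t =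
      g.dalembertian (f t) y
        - g.innerDual y (mvfderiv (𝓡 4) (fun _ : M ↦ c) y : TangentSpace (𝓡 4) y →ₗ[ℝ] ℝ)
            (mvfderiv (𝓡 4) (f t) y : TangentSpace (𝓡 4) y →ₗ[ℝ] ℝ)
        - g.gradSq (f t) y := by
    intro t ht y
    rw [innerDual_mvfderiv_const_left g, sub_zero]
    exact heq t ht y
  -- names: Fisher information, entropy, `∫ (Δf)² e^{-f} e^{-c}`, and `∫ ∂ₜ(|∇f|² e^{-f} e^{-c})`
  set If : ℝ → ℝ := fun s ↦
    ∫ y, g.gradSq (f s) y * Real.exp (-f s y) * Real.exp (-c) ∂g.riemVolume with hIfdef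
  set Hf : ℝ → ℝ := fun s ↦
    ∫ y, (-f s y) * Real.exp (-f s y) * Real.exp (-c) ∂g.riemVolume with hHfdef
  set D : ℝ → ℝ := fun s ↦
    ∫ y, (g.dalembertian (f s) y) ^ 2 * Real.exp (-f s y) * Real.exp (-c) ∂g.riemVolume with hDdef
  set I' : ℝ → ℝ := fun s ↦ ∫ y, derivWithin
    (fun r ↦ g.gradSq (f r) y * Real.exp (-f r y) * Real.exp (-c)) (Ici 0) s ∂g.riemVolume
    with hI'def
  -- B1 at the constant weight
  have hdiss : ∀ t, 0 < t → I' t ≤ -2 * K * If t - (1 / 2 : ℝ) * D t := fun t ht ↦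
    hB1 M g hg (fun _ : M ↦ c) K hV hRic' f hf heq' t (le_of_lt ht)
  -- the Fisher information: continuity on `[0, ∞)`, Leibniz rule on `(0, ∞)`, nonnegativity
  have hqfam := contMDiffOn_gradSq_family g hS hf
  have hPfam : ContMDiffOn ((𝓡 4).prod 𝓘(ℝ, ℝ)) 𝓘(ℝ, ℝ) ∞
      (fun p : M × ℝ ↦ g.gradSq (f p.2) p.1 * Real.exp (-f p.2 p.1) * Real.exp (-c))
      (univ ×ˢ Ici 0) := by
    have hu : ContMDiffOn ((𝓡 4).prod 𝓘(ℝ, ℝ)) 𝓘(ℝ, ℝ) ∞ (fun p : M × ℝ ↦ Real.exp (-f p.2 p.1))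
        (univ ×ˢ Ici 0) := (Real.contDiff_exp.comp contDiff_neg).contMDiff.comp_contMDiffOn hf
    exact (hqfam.mul hu).mul contMDiffOn_const
  have hP'fam := contMDiffOn_derivWithin_time_of_uniqueDiffOn
    (u := fun s y ↦ g.gradSq (f s) y * Real.exp (-f s y) * Real.exp (-c)) hS hPfam
  have hIc : ContinuousOn If (Ici 0) :=
    continuousOn_integral_of_continuousOn_prod g.riemVolume isClosed_Ici hPfam.continuousOn
  have hId : ∀ t, 0 < t → HasDerivAt If (I' t) t := by
    intro t ht
    have ht' : t ∈ interior (Ici (0 : ℝ)) := by rw [interior_Ici]; exact ht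
    exact hasDerivAt_integral_of_continuousOn_prod g.riemVolume hPfam.continuousOn
      hP'fam.continuousOn
      (fun y s hs ↦ hasDerivWithinAt_time_of_contMDiffOn (k := ∞)
        (u := fun s y ↦ g.gradSq (f s) y * Real.exp (-f s y) * Real.exp (-c))
        (by simp) hPfam y hs) ht'
  have hInn : ∀ t, 0 ≤ t → 0 ≤ If t := fun t _ ↦ integral_nonneg fun y ↦
    mul_nonneg (mul_nonneg (g.gradSq_nonneg hg _ y) (Real.exp_pos _).le) (Real.exp_pos _).le
  -- the entropy: continuity on `[0, ∞)` and `H' = −I` on `(0, ∞)`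
  have hRfam : ContMDiffOn ((𝓡 4).prod 𝓘(ℝ, ℝ)) 𝓘(ℝ, ℝ) ∞
      (fun p : M × ℝ ↦ (-f p.2 p.1) * Real.exp (-f p.2 p.1) * Real.exp (-c))
      (univ ×ˢ Ici 0) := by
    have hu : ContMDiffOn ((𝓡 4).prod 𝓘(ℝ, ℝ)) 𝓘(ℝ, ℝ) ∞ (fun p : M × ℝ ↦ Real.exp (-f p.2 p.1))
        (univ ×ˢ Ici 0) := (Real.contDiff_exp.comp contDiff_neg).contMDiff.comp_contMDiffOn hf
    exact (hf.neg.mul hu).mul contMDiffOn_const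
  have hHc : ContinuousOn Hf (Ici 0) :=
    continuousOn_integral_of_continuousOn_prod g.riemVolume isClosed_Ici hRfam.continuousOn
  have hHd : ∀ t, 0 < t → HasDerivAt Hf (-If t) t := fun t ht ↦
    hasDerivAt_entropy g hg hV hf heq' ht
  -- Green and Cauchy–Schwarz: `I² ≤ D`
  have hCS : ∀ t, 0 ≤ t → (If t) ^ 2 ≤ D t := by
    intro t ht
    have hF : ContMDiff (𝓡 4) 𝓘(ℝ, ℝ) ∞ (f t) :=
      hf.comp_contMDiff (contMDiff_id.prodMk contMDiff_const) fun y ↦ ⟨mem_univ _, ht⟩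
    have hF2 : ContMDiff (𝓡 4) 𝓘(ℝ, ℝ) 2 (f t) := hF.of_le (WithTop.coe_le_coe.mpr le_top)
    have hGreen := integral_dalembertian_mul_exp_neg g hg hF c
    have hΔc : Continuous (g.dalembertian (f t)) := continuous_dalembertian g hF2
    have hUc : Continuous fun y ↦ Real.exp (-f t y) := Real.continuous_exp.comp hF.continuous.neg
    have hWc : Continuous fun y ↦ Real.exp (-f t y) * Real.exp (-c) := hUc.mul continuous_const
    have hw : ∀ y, 0 ≤ Real.exp (-f t y) * Real.exp (-c) := fun y ↦
      mul_nonneg (Real.exp_pos _).le (Real.exp_pos _).le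
    have i0 : Integrable (fun y ↦ Real.exp (-f t y) * Real.exp (-c)) g.riemVolume :=
      g.integrable_of_continuous hWc
    have i1 : Integrable (fun y ↦ g.dalembertian (f t) y * (Real.exp (-f t y) * Real.exp (-c)))
        g.riemVolume := g.integrable_of_continuous (hΔc.mul hWc)
    have i2 : Integrable
        (fun y ↦ g.dalembertian (f t) y ^ 2 * (Real.exp (-f t y) * Real.exp (-c)))
        g.riemVolume := g.integrable_of_continuous ((hΔc.pow 2).mul hWc)
    have h := sq_integral_le_integral_sq_of_mass_one hw i0 i1 i2 (hmass t ht)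
    have e1 : ∫ y, g.dalembertian (f t) y * (Real.exp (-f t y) * Real.exp (-c)) ∂g.riemVolume =
        If t := by
      simp only [hIfdef]
      rw [← hGreen]
      exact integral_congr_ae (Eventually.of_forall fun y ↦ by ring)
    have e2 : ∫ y, g.dalembertian (f t) y ^ 2 * (Real.exp (-f t y) * Real.exp (-c))
        ∂g.riemVolume = D t := by
      simp only [hDdef]
      exact integral_congr_ae (Eventually.of_forall fun y ↦ by ring)
    rw [e1, e2] at h
    exact h
  -- the dimensional differential inequality `I' ≤ −2K I − ½ I²`
  have hI'le : ∀ t, 0 < t → I' t ≤ -2 * K * If t - (1 / 2 : ℝ) * (If t) ^ 2 := fun t ht ↦ by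
    linarith [hdiss t ht, hCS t (le_of_lt ht)]
  exact entropyEnergy_of_dissipation hK hHc hIc hHd hId hI'le hInn hlim

end Summit.SmoothPoincare4.SmoothPoincare4.Theorems

end
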